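import Literature.NumberTheory.EllipticCurves.Kato2004.AdmissibleZetaClass
import Literature.NumberTheory.EllipticCurves.IwasawaAlgebraGeneratorChange
import Literature.NumberTheory.EllipticCurves.PAdicPowerSeriesZeros
import HarnessLib

set_option linter.dupNamespace false

/-!
# (L-M) The VALUE of Kato's Λ-adic multiplier `katoMultiplier` at a point `ζ − 1`, `ζ^{pⁿ} = 1`, of the open unit
# disc of `ℂ_p` — for the twist-scalar law `hC` of stub 2c-T1 on crux `CccOneLawOnTypeIstarZero`
# (stmt-BirchSwinnertonDyer-19223, route `InertBadSignedBranches`, skeleton istar v15)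

Def-free helper file (theorems only; `--supports stmt-BirchSwinnertonDyer-19223`), refill hand
`leafhand-bsd-inertbadsignedbran-9` g0, docket of host bsd-eis-plan g43 (eis STATUS l.8229 (2)) / pen bsd-cm-plan g40
(D1208): PRIORITY 1 (L-M) — «the `Ψ(σ_c)`-specialisation of `Kato2004.katoMultiplier` at `ψ₀(γ) − 1`».  k-ty1 g39's
named hypothesis `hC` of `stub2cT1_of_colPlusInterpolation` quantifies `∀ t, HasSum (k ↦ ι(coeff_k (w·M̃))·(ψ(γ)−1)^k) t → …`
with `M̃ = katoMultiplier p c d₁ n₁ n₂ n₃ n₄ Ψ(σ_c) Ψ(σ_{d₁}) (prime(A)∖{p}) (a_ℓ) (ε_ℓ) (Ψ(σ_ℓ))`; this file COMPUTES that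
`t`: evaluation at a point `z` with `‖z‖ < 1` is a ring homomorphism on `Λ = ℤ_p⟦T⟧` (tree: `tsum_map_coeff_mul_mul_pow`,
`summable_map_coeff_mul_pow`, `hasSum_map_coeff_coe_mul_pow` of `PAdicPowerSeriesZeros`), it kills `ω_n·Λ` at the
`ζ − 1` with `ζ^{pⁿ} = 1`, and `(1+T)^x ≡ (1+T)^m (mod ω_n)` for `x ≡ m (mod pⁿ)` (tree:
`exists_binomialSeries_sub_pow_eq` of `IwasawaAlgebraGeneratorChange`), so the Iwasawa character value
`Ψ(σ) = (1+T)^{κσ}` evaluates to `ζ^{m_σ}`, `m_σ ≡ κσ (mod pⁿ)`, and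
`M̃(ζ − 1) = (c²d₁²n₁ − cd₁²n₂ ζ^{m_c} − c²d₁n₃ ζ^{m_d} + cd₁n₄ ζ^{m_c}ζ^{m_d}) · ∏_ℓ (ℓ² ζ^{2m_ℓ} − a_ℓ ℓ ζ^{m_ℓ} + ε_ℓ ℓ)`
— Kato's four-cusp factor `R⁻` with `σ_c ↦ ζ^{m_c}` times the cleared Euler factors `ℓ²P_ℓ(ℓ⁻¹σ_ℓ⁻¹)·(ℓσ_ℓ)²` with
`σ_ℓ ↦ ζ^{m_ℓ}` (the depletion bracket), in `ℂ_p`; and `t = w(ζ−1) · M̃(ζ−1)` for the `t` of `hC`.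

WHAT IS NOT HERE: the dictionary `ζ^{m_σ} = θ(χ_cyc σ)` between `κ` and Dirichlet characters (tree, Kato-rigid files
`apply_cyc_eq_pow` in `aeval` currency); the identification of the bracket with `L_S/L` at `s = 1`; `hC` itself.
HONEST LABEL: helper lemmas (Λ-algebra); nothing about `hC`, 2c-T1, 19223, X12 or BSD is proved; 2c-T1 NOT closed;
19223 OPEN; BSD is proved for no curve.
-/

noncomputable section

open scoped Classical

open Polynomial Literature.NumberTheory.EllipticCurves Literature.NumberTheory.EllipticCurves.Kato2004

namespace Summit.BirchSwinnertonDyer.BirchSwinnertonDyer.Theorems.CccOneTwistScalarMultiplierValue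

variable {p : ℕ} [Fact p.Prime]

/-! ## §1 Evaluation on the open unit disc of `ℂ_p` is a ring homomorphism on `Λ = ℤ_p⟦T⟧` -/

section Eval

variable (φ : ℤ_[p] →+* ℂ_[p]) (hφ : ∀ (G : PowerSeries ℤ_[p]) (k : ℕ), ‖φ (PowerSeries.coeff k G)‖ ≤ 1)
  {z : ℂ_[p]} (hz : ‖z‖ < 1)

include hφ hz in
/-- The evaluation series of an element of `Λ` at `‖z‖ < 1` is summable. [cite: Washington1997, §7.1] -/
theorem summable_eval (A : PowerSeries ℤ_[p]) : Summable fun k ↦ φ (PowerSeries.coeff k A) * z ^ k :=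
  summable_map_coeff_mul_pow φ (hφ A) hz

include hφ hz in
/-- Evaluation is multiplicative. [cite: Washington1997, §7.1] -/
theorem tsum_eval_mul (A B : PowerSeries ℤ_[p]) :
    ∑' k, φ (PowerSeries.coeff k (A * B)) * z ^ k =
      (∑' k, φ (PowerSeries.coeff k A) * z ^ k) * ∑' k, φ (PowerSeries.coeff k B) * z ^ k :=
  tsum_map_coeff_mul_mul_pow φ (hφ A) (hφ B) hz

include hφ hz in
/-- Evaluation is additive. [cite: Washington1997, §7.1] -/
theorem tsum_eval_add (A B : PowerSeries ℤ_[p]) :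
    ∑' k, φ (PowerSeries.coeff k (A + B)) * z ^ k =
      (∑' k, φ (PowerSeries.coeff k A) * z ^ k) + ∑' k, φ (PowerSeries.coeff k B) * z ^ k := by
  rw [← (summable_eval φ hφ hz A).tsum_add (summable_eval φ hφ hz B)]
  refine tsum_congr fun k ↦ ?_
  rw [map_add, map_add, add_mul]

include hφ hz in
/-- Evaluation respects subtraction. [cite: Washington1997, §7.1] -/
theorem tsum_eval_sub (A B : PowerSeries ℤ_[p]) :
    ∑' k, φ (PowerSeries.coeff k (A - B)) * z ^ k =
      (∑' k, φ (PowerSeries.coeff k A) * z ^ k) - ∑' k, φ (PowerSeries.coeff k B) * z ^ k := by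
  rw [← (summable_eval φ hφ hz A).tsum_sub (summable_eval φ hφ hz B)]
  refine tsum_congr fun k ↦ ?_
  rw [map_sub, map_sub, sub_mul]

/-- Evaluation of (the coercion of) a polynomial is its value. [folklore] -/
theorem tsum_eval_coe (P : ℤ_[p][X]) (z : ℂ_[p]) :
    ∑' k, φ (PowerSeries.coeff k (P : PowerSeries ℤ_[p])) * z ^ k = P.eval₂ φ z :=
  (hasSum_map_coeff_coe_mul_pow φ P z).tsum_eq

/-- Evaluation of an integer constant. [folklore] -/
theorem tsum_eval_intCast (c : ℤ) (z : ℂ_[p]) :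
    ∑' k, φ (PowerSeries.coeff k ((c : PowerSeries ℤ_[p]))) * z ^ k = c := by
  have h : ((Polynomial.C (c : ℤ_[p]) : ℤ_[p][X]) : PowerSeries ℤ_[p]) = (c : PowerSeries ℤ_[p]) := by
    rw [Polynomial.coe_C, map_intCast]
  rw [← h, tsum_eval_coe, Polynomial.eval₂_C, map_intCast]

/-- Evaluation of a natural-number constant. [folklore] -/
theorem tsum_eval_natCast (c : ℕ) (z : ℂ_[p]) :
    ∑' k, φ (PowerSeries.coeff k ((c : PowerSeries ℤ_[p]))) * z ^ k = c := by
  have h := tsum_eval_intCast φ (c : ℤ) z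
  rwa [Int.cast_natCast, Int.cast_natCast] at h

/-- Evaluation of `1`. [folklore] -/
theorem tsum_eval_one (z : ℂ_[p]) :
    ∑' k, φ (PowerSeries.coeff k (1 : PowerSeries ℤ_[p])) * z ^ k = 1 := by
  have h := tsum_eval_natCast φ 1 z
  rwa [Nat.cast_one, Nat.cast_one] at h

include hφ hz in
/-- Evaluation respects powers. [cite: Washington1997, §7.1] -/
theorem tsum_eval_pow (A : PowerSeries ℤ_[p]) (n : ℕ) :
    ∑' k, φ (PowerSeries.coeff k (A ^ n)) * z ^ k = (∑' k, φ (PowerSeries.coeff k A) * z ^ k) ^ n := by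
  induction n with
  | zero => rw [pow_zero, pow_zero, tsum_eval_one]
  | succ n ih => rw [pow_succ, tsum_eval_mul φ hφ hz, ih, pow_succ]

include hφ hz in
/-- Evaluation respects finite products. [cite: Washington1997, §7.1] -/
theorem tsum_eval_prod {α : Type*} (s : Finset α) (F : α → PowerSeries ℤ_[p]) :
    ∑' k, φ (PowerSeries.coeff k (∏ i ∈ s, F i)) * z ^ k =
      ∏ i ∈ s, ∑' k, φ (PowerSeries.coeff k (F i)) * z ^ k := by
  induction s using Finset.induction_on with
  | empty => rw [Finset.prod_empty, Finset.prod_empty, tsum_eval_one]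
  | insert a s ha ih => rw [Finset.prod_insert ha, Finset.prod_insert ha, tsum_eval_mul φ hφ hz, ih]

include hφ hz in
/-- **`ω_n·Λ` dies at the `ζ − 1`, `ζ^{pⁿ} = 1`**: `((1+T)^{pⁿ} − 1)·q` evaluates to `0` at `z` with `(1+z)^{pⁿ} = 1`.
[cite: Washington1997, §7.2] -/
theorem tsum_eval_omega_mul (n : ℕ) (q : PowerSeries ℤ_[p]) (hzn : (1 + z) ^ p ^ n = 1) :
    ∑' k, φ (PowerSeries.coeff k ((((1 + PowerSeries.X : PowerSeries ℤ_[p]) ^ p ^ n - 1)) * q)) * z ^ k = 0 := by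
  have hω : ((1 + PowerSeries.X : PowerSeries ℤ_[p]) ^ p ^ n - 1) =
      ((((1 + X : ℤ_[p][X]) ^ p ^ n - 1 : ℤ_[p][X])) : PowerSeries ℤ_[p]) := by
    simp only [Polynomial.coe_sub, Polynomial.coe_pow, Polynomial.coe_add, Polynomial.coe_one, Polynomial.coe_X]
  rw [tsum_eval_mul φ hφ hz, hω, tsum_eval_coe]
  simp only [Polynomial.eval₂_sub, Polynomial.eval₂_pow, Polynomial.eval₂_add, Polynomial.eval₂_one,
    Polynomial.eval₂_X, hzn, sub_self, zero_mul]

include hφ hz in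
/-- **The Iwasawa power `(1+T)^x` at `ζ − 1`**: for `x ∈ ℤ_p` with `x ≡ m (mod pⁿ)` and `(1+z)^{pⁿ} = 1`,
`(1+T)^x` evaluates at `z` to `(1+z)^m` (`(1+T)^x ≡ (1+T)^m (mod ω_n)`, tree `exists_binomialSeries_sub_pow_eq`).
[cite: Washington1997, §13.2 and §7.2] -/
theorem tsum_eval_onePlusTPow (x : ℤ_[p]) (n : ℕ) (hzn : (1 + z) ^ p ^ n = 1) {m : ℕ}
    (hm : PadicInt.toZModPow n x = (m : ZMod (p ^ n))) :
    ∑' k, φ (PowerSeries.coeff k ((IwasawaCharacter.onePlusTPow p ℤ_[p] x : (PowerSeries ℤ_[p])ˣ) :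
        PowerSeries ℤ_[p])) * z ^ k = (1 + z) ^ m := by
  obtain ⟨q, hq⟩ := exists_binomialSeries_sub_pow_eq (n := n) (x := x) (m := m) hm
  have hx : ((IwasawaCharacter.onePlusTPow p ℤ_[p] x : (PowerSeries ℤ_[p])ˣ) : PowerSeries ℤ_[p]) =
      (1 + PowerSeries.X : PowerSeries ℤ_[p]) ^ m + ((1 + PowerSeries.X : PowerSeries ℤ_[p]) ^ p ^ n - 1) * q := by
    rw [IwasawaCharacter.val_onePlusTPow]
    linear_combination hq
  have hpoly : ((1 + PowerSeries.X : PowerSeries ℤ_[p]) ^ m) =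
      ((((1 + X : ℤ_[p][X]) ^ m : ℤ_[p][X])) : PowerSeries ℤ_[p]) := by
    simp only [Polynomial.coe_pow, Polynomial.coe_add, Polynomial.coe_one, Polynomial.coe_X]
  rw [hx, tsum_eval_add φ hφ hz, tsum_eval_omega_mul φ hφ hz n q hzn, add_zero, hpoly, tsum_eval_coe]
  simp only [Polynomial.eval₂_pow, Polynomial.eval₂_add, Polynomial.eval₂_one, Polynomial.eval₂_X]

include hφ hz in
/-- **The Iwasawa character value `Ψ(σ) = (1+T)^{κσ}` at `ζ − 1`** (`ζ^{pⁿ} = 1`): `(1+z)^{m}` for any `m ≡ κσ (mod pⁿ)`.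
[cite: Washington1997, §13.2] [cite: Castella2018, §2.2 (p. 5)] -/
theorem tsum_eval_psi (κ : ZpExtension ℚ p) (σ : Field.absoluteGaloisGroup ℚ) (n : ℕ) (hzn : (1 + z) ^ p ^ n = 1)
    {m : ℕ} (hm : PadicInt.toZModPow n (κ σ).toAdd = (m : ZMod (p ^ n))) :
    ∑' k, φ (PowerSeries.coeff k ((IwasawaCharacter.Psi p ℤ_[p] κ σ : (PowerSeries ℤ_[p])ˣ) :
        PowerSeries ℤ_[p])) * z ^ k = (1 + z) ^ m := by
  rw [IwasawaCharacter.Psi_apply]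
  exact tsum_eval_onePlusTPow φ hφ hz _ n hzn hm

end Eval

/-! ## §2 The multiplier evaluated -/

section Multiplier

variable (φ : ℤ_[p] →+* ℂ_[p]) (hφ : ∀ (G : PowerSeries ℤ_[p]) (k : ℕ), ‖φ (PowerSeries.coeff k G)‖ ≤ 1)
  {z : ℂ_[p]} (hz : ‖z‖ < 1)

include hφ hz in
/-- **`katoMultiplier` evaluated at `‖z‖ < 1`**: the evaluation homomorphism applied to
`M̃ = (c²d²n₁ − cd²n₂Ψ_c − c²dn₃Ψ_d + cdn₄Ψ_cΨ_d)·∏_ℓ(ℓ²Ψ_ℓ² − a_ℓℓΨ_ℓ + ε_ℓℓ)` substitutes the VALUES of `Ψ_c, Ψ_d, Ψ_ℓ`.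
[cite: Kato2004Asterisque, Thm. 6.6 (1) (p. 163), §13.9 (p. 229), Lemma 13.10 (1) (p. 230)] -/
theorem tsum_eval_katoMultiplier (c d n₁ n₂ n₃ n₄ : ℤ) (Ψc Ψd : IwasawaAlgebra p) (E : Finset ℕ)
    (aℓ εℓ : ℕ → ℤ) (Ψℓ : ℕ → IwasawaAlgebra p) :
    ∑' k, φ (PowerSeries.coeff k (katoMultiplier p c d n₁ n₂ n₃ n₄ Ψc Ψd E aℓ εℓ Ψℓ)) * z ^ k =
      (((c ^ 2 * d ^ 2 * n₁ : ℤ) : ℂ_[p]) - ((c * d ^ 2 * n₂ : ℤ) : ℂ_[p]) * (∑' k, φ (PowerSeries.coeff k Ψc) * z ^ k)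
          - ((c ^ 2 * d * n₃ : ℤ) : ℂ_[p]) * (∑' k, φ (PowerSeries.coeff k Ψd) * z ^ k)
          + ((c * d * n₄ : ℤ) : ℂ_[p]) * (∑' k, φ (PowerSeries.coeff k Ψc) * z ^ k) *
              (∑' k, φ (PowerSeries.coeff k Ψd) * z ^ k)) *
        ∏ ℓ ∈ E, (((ℓ ^ 2 : ℕ) : ℂ_[p]) * (∑' k, φ (PowerSeries.coeff k (Ψℓ ℓ)) * z ^ k) ^ 2
          - ((aℓ ℓ * ℓ : ℤ) : ℂ_[p]) * (∑' k, φ (PowerSeries.coeff k (Ψℓ ℓ)) * z ^ k)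
          + ((εℓ ℓ * ℓ : ℤ) : ℂ_[p])) := by
  unfold katoMultiplier
  rw [tsum_eval_mul φ hφ hz, tsum_eval_prod φ hφ hz]
  congr 1
  · rw [tsum_eval_add φ hφ hz, tsum_eval_sub φ hφ hz, tsum_eval_sub φ hφ hz, tsum_eval_mul φ hφ hz,
      tsum_eval_mul φ hφ hz, tsum_eval_mul φ hφ hz, tsum_eval_mul φ hφ hz, tsum_eval_intCast,
      tsum_eval_intCast, tsum_eval_intCast, tsum_eval_intCast]
  · refine Finset.prod_congr rfl fun ℓ _ ↦ ?_
    rw [tsum_eval_add φ hφ hz, tsum_eval_sub φ hφ hz, tsum_eval_mul φ hφ hz, tsum_eval_mul φ hφ hz,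
      tsum_eval_pow φ hφ hz, tsum_eval_natCast, tsum_eval_intCast, tsum_eval_intCast]

include hφ hz in
/-- **`M̃(ζ − 1)` for the Iwasawa-character arguments of the position clause (A6′)**: with `Ψ_c = Ψ(σ_c)`, `Ψ_d = Ψ(σ_d)`,
`Ψ_ℓ = Ψ(σ_ℓ)`, `(1+z)^{pⁿ} = 1` (`z = ζ − 1`) and naturals `m_c ≡ κσ_c`, `m_d ≡ κσ_d`, `m_ℓ ≡ κσ_ℓ (mod pⁿ)`:
`M̃(ζ−1) = (c²d²n₁ − cd²n₂ζ^{m_c} − c²dn₃ζ^{m_d} + cdn₄ζ^{m_c}ζ^{m_d})·∏_ℓ(ℓ²ζ^{2m_ℓ} − a_ℓℓζ^{m_ℓ} + ε_ℓℓ)`, `ζ = 1 + z`.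
[cite: Kato2004Asterisque, §13.9 (p. 229), Lemma 13.10 (1) (p. 230)] [cite: Washington1997, §13.2] -/
theorem tsum_eval_katoMultiplier_psi (κ : ZpExtension ℚ p) (c d n₁ n₂ n₃ n₄ : ℤ)
    (σc σd : Field.absoluteGaloisGroup ℚ) (E : Finset ℕ) (aℓ εℓ : ℕ → ℤ) (σℓ : ℕ → Field.absoluteGaloisGroup ℚ)
    (n : ℕ) (hzn : (1 + z) ^ p ^ n = 1) {mc md : ℕ} {mℓ : ℕ → ℕ}
    (hmc : PadicInt.toZModPow n (κ σc).toAdd = (mc : ZMod (p ^ n)))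
    (hmd : PadicInt.toZModPow n (κ σd).toAdd = (md : ZMod (p ^ n)))
    (hmℓ : ∀ ℓ ∈ E, PadicInt.toZModPow n (κ (σℓ ℓ)).toAdd = (mℓ ℓ : ZMod (p ^ n))) :
    ∑' k, φ (PowerSeries.coeff k
        (katoMultiplier p c d n₁ n₂ n₃ n₄
          ((IwasawaCharacter.Psi p ℤ_[p] κ σc : (PowerSeries ℤ_[p])ˣ) : IwasawaAlgebra p)
          ((IwasawaCharacter.Psi p ℤ_[p] κ σd : (PowerSeries ℤ_[p])ˣ) : IwasawaAlgebra p) E aℓ εℓ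
          (fun ℓ ↦ ((IwasawaCharacter.Psi p ℤ_[p] κ (σℓ ℓ) : (PowerSeries ℤ_[p])ˣ) : IwasawaAlgebra p)))) *
        z ^ k =
      (((c ^ 2 * d ^ 2 * n₁ : ℤ) : ℂ_[p]) - ((c * d ^ 2 * n₂ : ℤ) : ℂ_[p]) * (1 + z) ^ mc
          - ((c ^ 2 * d * n₃ : ℤ) : ℂ_[p]) * (1 + z) ^ md
          + ((c * d * n₄ : ℤ) : ℂ_[p]) * (1 + z) ^ mc * (1 + z) ^ md) *
        ∏ ℓ ∈ E, (((ℓ ^ 2 : ℕ) : ℂ_[p]) * ((1 + z) ^ mℓ ℓ) ^ 2 - ((aℓ ℓ * ℓ : ℤ) : ℂ_[p]) * (1 + z) ^ mℓ ℓ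
          + ((εℓ ℓ * ℓ : ℤ) : ℂ_[p])) := by
  rw [tsum_eval_katoMultiplier φ hφ hz, tsum_eval_psi φ hφ hz κ σc n hzn hmc, tsum_eval_psi φ hφ hz κ σd n hzn hmd]
  congr 1
  refine Finset.prod_congr rfl fun ℓ hℓ ↦ ?_
  rw [tsum_eval_psi φ hφ hz κ (σℓ ℓ) n hzn (hmℓ ℓ hℓ)]

include hφ hz in
/-- **The `t` of `hC`.** If `HasSum (k ↦ φ(coeff_k (w·M̃))·z^k) t` then `t = w(z)·M̃(z)` (uniqueness of sums in `ℂ_p` and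
multiplicativity of evaluation); combine with `tsum_eval_katoMultiplier_psi` for the closed form.
[cite: Washington1997, §7.1] -/
theorem eq_of_hasSum_coeff_mul (w M : IwasawaAlgebra p) {t : ℂ_[p]}
    (ht : HasSum (fun k ↦ φ (PowerSeries.coeff k (w * M)) * z ^ k) t) :
    t = (∑' k, φ (PowerSeries.coeff k w) * z ^ k) * ∑' k, φ (PowerSeries.coeff k M) * z ^ k := by
  rw [← ht.tsum_eq, tsum_eval_mul φ hφ hz]

end Multiplier

/-! ## §3 The points of `hC`: `ζ = ψ(γ̃)` for a `ℂ_p`-valued Dirichlet character `ψ` mod `p^{n+1}`, `p` odd -/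

section Points

/-- For `p` odd, `γ̃ = cyclotomicGenerator p = 1 + p` has order `pⁿ` in `(ℤ/p^{n+1})ˣ` (tree `orderOf_cyclotomicGenerator`),
so `ψ(γ̃)^{pⁿ} = 1` for every Dirichlet character `ψ` mod `p^{n+1}`. [cite: MazurTateTeitelbaum1986Invent, §I.13] -/
theorem apply_cyclotomicGenerator_pow_prime_pow (hp : p ≠ 2) (n : ℕ)
    (ψ : DirichletCharacter ℂ_[p] (p ^ (n + 1))) :
    ψ (cyclotomicGenerator p : ZMod (p ^ (n + 1))) ^ p ^ n = 1 := by
  have he : cyclotomicExponent p = 1 := if_neg hp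
  have h := orderOf_cyclotomicGenerator p n
  rw [he] at h
  rw [← map_pow, ← h, pow_orderOf_eq_one, map_one]

/-- The evaluation point `ψ(γ̃) − 1` of `hC` / `ColPlusInterpolation` / `IsQuadraticBranchPlusLFunction` lies in the open
unit disc of `ℂ_p` (tree `norm_sub_one_lt_one_of_pow_prime_pow_eq_one`). [cite: Washington1997, §7.2] -/
theorem norm_apply_cyclotomicGenerator_sub_one_lt (hp : p ≠ 2) (n : ℕ)
    (ψ : DirichletCharacter ℂ_[p] (p ^ (n + 1))) :
    ‖ψ (cyclotomicGenerator p : ZMod (p ^ (n + 1))) - 1‖ < 1 :=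
  norm_sub_one_lt_one_of_pow_prime_pow_eq_one (apply_cyclotomicGenerator_pow_prime_pow hp n ψ)

/-- **(L-M) IN THE SHAPE OF `hC`.**  For `p` odd, a `ℂ_p`-valued Dirichlet character `ψ` mod `p^{n+1}` with `ζ := ψ(γ̃)`,
any `w ∈ Λ`, Kato's multiplier `M̃` on the Iwasawa-character arguments `Ψ(σ_c), Ψ(σ_d), Ψ(σ_ℓ)` of (A5′)/(A6′), and
naturals `m_c ≡ κσ_c`, `m_d ≡ κσ_d`, `m_ℓ ≡ κσ_ℓ (mod pⁿ)`: the `t` with `HasSum (k ↦ ι(coeff_k (w·M̃))·(ζ − 1)^k) t`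
(the `t` quantified in `hC`) IS
`t = w(ζ − 1) · (c²d²n₁ − cd²n₂ ζ^{m_c} − c²dn₃ ζ^{m_d} + cdn₄ ζ^{m_c} ζ^{m_d}) · ∏_ℓ (ℓ² (ζ^{m_ℓ})² − a_ℓ ℓ ζ^{m_ℓ} + ε_ℓ ℓ)`,
`w(ζ − 1) = Σ_k ι(w_k)(ζ−1)^k`.  (The identification `ζ^{m_σ} = θ(χ_cyc σ)` with the `W`-currency character `θ` of `ψ` is the
character dictionary of the Kato-rigid files, not repeated here.)
[cite: Kato2004Asterisque, §13.9 (p. 229), Lemma 13.10 (1) (p. 230)] [cite: Washington1997, §7.1–7.2, §13.2] -/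
theorem eq_of_hasSum_coeff_mul_katoMultiplier (hp : p ≠ 2) (n : ℕ) (ψ : DirichletCharacter ℂ_[p] (p ^ (n + 1)))
    (κ : ZpExtension ℚ p) (c d n₁ n₂ n₃ n₄ : ℤ) (σc σd : Field.absoluteGaloisGroup ℚ) (E : Finset ℕ)
    (aℓ εℓ : ℕ → ℤ) (σℓ : ℕ → Field.absoluteGaloisGroup ℚ) {mc md : ℕ} {mℓ : ℕ → ℕ}
    (hmc : PadicInt.toZModPow n (κ σc).toAdd = (mc : ZMod (p ^ n)))
    (hmd : PadicInt.toZModPow n (κ σd).toAdd = (md : ZMod (p ^ n)))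
    (hmℓ : ∀ ℓ ∈ E, PadicInt.toZModPow n (κ (σℓ ℓ)).toAdd = (mℓ ℓ : ZMod (p ^ n)))
    (w : IwasawaAlgebra p) {t : ℂ_[p]}
    (ht : HasSum (fun k : ℕ ↦ ((algebraMap ℚ_[p] ℂ_[p]).comp (algebraMap ℤ_[p] ℚ_[p]))
        (PowerSeries.coeff k (w *
          katoMultiplier p c d n₁ n₂ n₃ n₄
            ((IwasawaCharacter.Psi p ℤ_[p] κ σc : (PowerSeries ℤ_[p])ˣ) : IwasawaAlgebra p)
            ((IwasawaCharacter.Psi p ℤ_[p] κ σd : (PowerSeries ℤ_[p])ˣ) : IwasawaAlgebra p) E aℓ εℓ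
            (fun ℓ ↦ ((IwasawaCharacter.Psi p ℤ_[p] κ (σℓ ℓ) : (PowerSeries ℤ_[p])ˣ) : IwasawaAlgebra p)))) *
        (ψ (cyclotomicGenerator p : ZMod (p ^ (n + 1))) - 1) ^ k) t) :
    t = (∑' k : ℕ, ((algebraMap ℚ_[p] ℂ_[p]).comp (algebraMap ℤ_[p] ℚ_[p])) (PowerSeries.coeff k w) *
          (ψ (cyclotomicGenerator p : ZMod (p ^ (n + 1))) - 1) ^ k) *
      ((((c ^ 2 * d ^ 2 * n₁ : ℤ) : ℂ_[p])
          - ((c * d ^ 2 * n₂ : ℤ) : ℂ_[p]) * ψ (cyclotomicGenerator p : ZMod (p ^ (n + 1))) ^ mc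
          - ((c ^ 2 * d * n₃ : ℤ) : ℂ_[p]) * ψ (cyclotomicGenerator p : ZMod (p ^ (n + 1))) ^ md
          + ((c * d * n₄ : ℤ) : ℂ_[p]) * ψ (cyclotomicGenerator p : ZMod (p ^ (n + 1))) ^ mc *
              ψ (cyclotomicGenerator p : ZMod (p ^ (n + 1))) ^ md) *
        ∏ ℓ ∈ E, (((ℓ ^ 2 : ℕ) : ℂ_[p]) * (ψ (cyclotomicGenerator p : ZMod (p ^ (n + 1))) ^ mℓ ℓ) ^ 2
          - ((aℓ ℓ * ℓ : ℤ) : ℂ_[p]) * ψ (cyclotomicGenerator p : ZMod (p ^ (n + 1))) ^ mℓ ℓ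
          + ((εℓ ℓ * ℓ : ℤ) : ℂ_[p]))) := by
  have hz : ‖ψ (cyclotomicGenerator p : ZMod (p ^ (n + 1))) - 1‖ < 1 :=
    norm_apply_cyclotomicGenerator_sub_one_lt hp n ψ
  have hzn : (1 + (ψ (cyclotomicGenerator p : ZMod (p ^ (n + 1))) - 1)) ^ p ^ n = 1 := by
    rw [add_sub_cancel]
    exact apply_cyclotomicGenerator_pow_prime_pow hp n ψ
  rw [eq_of_hasSum_coeff_mul _ norm_algebraMap_coeff_le_one hz _ _ ht,
    tsum_eval_katoMultiplier_psi _ norm_algebraMap_coeff_le_one hz κ c d n₁ n₂ n₃ n₄ σc σd E aℓ εℓ σℓ n hzn hmc hmd hmℓ,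
    add_sub_cancel]

end Points

end Summit.BirchSwinnertonDyer.BirchSwinnertonDyer.Theorems.CccOneTwistScalarMultiplierValue

end
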